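import Literature.AnabelianGeometry.EtaleTheta.ThetaCoversTemperedModelDefs
import HarnessLib

/-!
# A second MODEL of the tempered theta-covering interface ([EtTh] §2): the HEISENBERG variant — `Δ̄_Θ` is the
# commutator direction (so the printed «`Δ_Θ := Im(∧² Δ^ab_X)`» HOLDS), the Tate factor `Ẑ` lies in `Ker(Δ_X ↠ Δ̄_X)`

S. Mochizuki, *The étale theta function …*, Publ. RIMS **45** (2009) [MochizukiEtTh2009], §1 p.238 (PDF p.12) «`Δ_Θ :=
Im(∧² Δ^ab_X)`», §2 Def. 2.1 – 2.5 (PDF pp.36–40).  abc-iut cell, layer L2, seat abc-iut-w5-d118 (sequel of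
`ThetaCoversTemperedModelDefs.lean` p430754: same carriers `Π_C = Â × Ẑ ⊇ Π^tp_C = A × ℤ`, same `Φ : Π_C → (ℤ/l × ℤ/l) ⋊ D_l`).
CONSISTENCY WITNESS / TOY (`G_K = 1`); DEF-BEARING (post-freeze class (b) MODEL file: three `abbrev`/`def`s, no frozen structure
touched, no instance).

THE VARIANT.  The first model (`TemperedModel.coverDataAx`) took `Δ̄_Θ :=` the Tate direction `Ẑ/lẐ` and killed the Heisenberg
coordinate `c`, so its `Δ̄_X ≅ (ℤ/l)³` is ABELIAN (certificate `Sec2CoverDataHThetaIndependence.lean`: the binder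
`hΘ : ⁅Δ_X, Δ_X⁆ · Ker = Δ̄_Θ-preimage` of GAP-LEDGER G-L2d3-1 fails there).  Here instead the whole toy is PULLED BACK along
`Φ`: `Ker(Δ_X ↠ Δ̄_X) := Ker Φ` (⊇ the Tate factor `1 × Ẑ`), `Δ̄_Θ-preimage := Φ⁻¹(heisTheta)`, so `Δ̄_X ≅ heisPiX` IS the
mod-`l` Heisenberg group and `hΘ` HOLDS (`Φ⁻¹(⁅heisPiX, heisPiX⁆) = ⁅Π_X, Π_X⁆ · Ker Φ`); the `(−1)`-eigenspace datum is
`E := Φ⁻¹(heisE)`, the splitting `S := Ker Φ`, `Π_C̲̲ := (S·E)·⟨ι̲⟩`.  The tempered layer of `Sec2TemperedCoverDataModel.lean` is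
unchanged.  Purpose (proof-only sequel `Discharge/Sec2TemperedCoverDataModelHeis.lean`): a binder-free `TemperedCoverData`
satisfying `hΘ` and `HasMuL` — the v-next field candidate `commutator_sup_barKer` (census item S2-3) is JOINTLY SATISFIABLE with
the tempered interface — at which the cusp stabiliser is still all of `Π^tp_C`, so [EtTh] Cor. 2.9's count fails for the cusp
reason ALONE (sharpened certificate for G-L2d3-2).  [cite: MochizukiEtTh2009, Def 2.1 p.36]
-/

noncomputable section

namespace Literature.AnabelianGeometry.EtaleTheta

namespace ThetaCovers

namespace TemperedModel

open Multiplicative HeisenbergWitness Literature.AnabelianGeometry.SemiGraphs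
  Literature.AnabelianGeometry.EtaleTheta.SettingModel

variable (l : ℕ) [NeZero l]

/-- `Ker Φ` is closed (a preimage of a point of a discrete space). (toy bookkeeping) [cite: MochizukiEtTh2009, Def 2.1 p.36] -/
theorem isClosed_ker_Phi : IsClosed ((Phi l).ker : Set (PiCM l)) := by
  have : ((Phi l).ker : Set (PiCM l)) = Phi l ⁻¹' {1} := by ext x; simp [MonoidHom.mem_ker]
  rw [this]
  exact isClosed_preimage_Phi l _

/-- `[Δ̄_Θ-preimage : Ker Φ] = l` (`= #heisTheta`). (toy bookkeeping) [cite: MochizukiEtTh2009, Def 2.1 p.36] -/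
theorem relIndex_ker_Phi_barThetaM : (Phi l).ker.relIndex (barThetaM l) = l := by
  rw [barThetaM, ← MonoidHom.comap_bot, Subgroup.relIndex_comap,
    Subgroup.map_comap_eq_self_of_surjective (Phi_surjective l), Subgroup.relIndex_bot_left, card_heisTheta]

/-- **The Heisenberg variant of the model's `CoverDataAx`**: as `TemperedModel.coverDataAx` except `Ker(Δ_X ↠ Δ̄_X) := Ker Φ` —
every axiom of Def. 2.1 / Rmk. 2.1.1 / Prop. 2.2 (i) is the toy's (`heisenbergWitness`, abc-iut-w5-d243) pulled back along the
surjection `Φ`. CONSISTENCY/TOY, `G_K = 1`. [cite: MochizukiEtTh2009, Def 2.1 p.36] -/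
abbrev coverDataAxH (hl : Odd l) : CoverDataAx.{0} l where
  l_odd := hl
  PiC := PiCM l
  GK := PUnit
  aug := 1
  PiX := PiXM l
  PiX_normal := by
    haveI : (heisPiX l).Normal := MonoidHom.normal_ker _
    exact Subgroup.Normal.comap inferInstance _
  index_PiX := by
    rw [PiXM, Subgroup.index_comap_of_surjective _ (Phi_surjective l), index_heisPiX]
  isOpen_PiX := by
    change IsOpen ((Phi l) ⁻¹' (heisPiX l : Set (heisPiC l)))
    exact isOpen_preimage_Phi l _
  aug_PiX_surjective := fun _ => ⟨1, Subsingleton.elim _ _⟩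
  barKer := (Phi l).ker
  barKer_normal := MonoidHom.normal_ker _
  isClosed_barKer := isClosed_ker_Phi l
  barTheta := barThetaM l
  barTheta_normal := (heisTheta_normal l).comap _
  barKer_le_barTheta := fun x hx => by
    change Phi l x ∈ heisTheta l
    rw [(MonoidHom.mem_ker).mp hx]
    exact (heisTheta l).one_mem
  barTheta_le := by
    rw [MonoidHom.ker_one, inf_top_eq]
    exact Subgroup.comap_mono (heisTheta_le_heisPiX l)
  relIndex_barKer := relIndex_ker_Phi_barThetaM l
  ell_rank_two := by
    haveI : (barThetaM l).Normal := (heisTheta_normal l).comap _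
    exact ⟨(QuotientGroup.quotientMulEquivOfEq (ellCoordsM_ker l).symm).trans
      (QuotientGroup.quotientKerEquivOfSurjective _ (ellCoordsM_surjective l))⟩
  barTheta_central := by
    intro t ht d hd
    rw [MonoidHom.ker_one, inf_top_eq] at hd
    rw [MonoidHom.mem_ker, map_mul, map_mul, map_mul, map_inv, map_inv]
    exact heis_central l hl ht hd
  Dx := barThetaM l
  Dx_le := Subgroup.comap_mono (heisTheta_le_heisPiX l)
  aug_Dx_surjective := fun _ => ⟨1, Subsingleton.elim _ _⟩
  inertia_sup_barKer := by
    rw [MonoidHom.ker_one, inf_top_eq]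
    refine sup_eq_left.mpr fun x hx => ?_
    change Phi l x ∈ heisTheta l
    rw [(MonoidHom.mem_ker).mp hx]
    exact (heisTheta l).one_mem
  pow_mem_barKer := by
    intro d hd
    rw [MonoidHom.ker_one, inf_top_eq] at hd
    rw [MonoidHom.mem_ker, map_pow]
    exact pow_eq_one l hl hd
  inv_ell := by
    intro c _ hc d hd
    rw [MonoidHom.ker_one, inf_top_eq] at hd
    change Phi l (c * d * c⁻¹ * d) ∈ heisTheta l
    rw [map_mul, map_mul, map_mul, map_inv]
    exact heis_inv_ell l hl hc hd
  inv_theta := by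
    intro c _ hc t ht
    rw [MonoidHom.mem_ker, map_mul, map_mul, map_mul, map_inv, map_inv]
    exact heis_inv_theta l hl hc ht

/-- `E := Φ⁻¹(heisE)` — the toy's `(−1)`-eigenspace datum `{(b, 0)} ⋊ 1` pulled back. (toy bookkeeping)
[cite: MochizukiEtTh2009, Prop 2.2 (i) p.37] -/
def EH : Subgroup (PiCM l) := (heisE l).comap (Phi l)

/-- `Π_C̲̲ := (Ker Φ · E) · ⟨ι̲⟩` for the Heisenberg variant (Def. 2.3). (toy bookkeeping) [cite: MochizukiEtTh2009, Def 2.3 p.38] -/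
def PiCuuH : Subgroup (PiCM l) := ((Phi l).ker ⊔ EH l) ⊔ Subgroup.zpowers (iotaM l)

end TemperedModel

end ThetaCovers

end Literature.AnabelianGeometry.EtaleTheta
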